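import Literature.NumberTheory.GaloisRepresentations.IdeleClassBarSModAlphaOneInjective
import Literature.NumberTheory.GaloisRepresentations.IdeleClassBarModAlphaOneSurjective
import Literature.NumberTheory.GaloisRepresentations.GlobalReciprocityBidualityUnramifiedLayers
import HarnessLib

/-!
# Milne's (b) for `(Gal(K_S/L), Res C̄_S)`, surjectivity side: every additive functional on `Ext¹_{C_{V̄_L}}(ℤ, ℤ/m)` is
# `χ ↦ inv (Inf (H²(id, φ_V) (β_m χ)))` on the trace-layer characters for ONE invariant vector `φ`
# (Milne ADT I Thm. 1.8 (b), §4; Harari Prop. 15.42 (a), Thm. 17.2; Tate C–F VII §11.3 + §5.1 (D))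

Topic `NumberTheory/GaloisRepresentations`; namespace `Literature.NumberTheory.GaloisRepresentations.IdeleClassBar`.  The S-port
of door-c4 g17's `IdeleClassBarAbsoluteGaloisTransport` (§37) and `IdeleClassBarModAlphaOneSurjective` (§39–§42) to the
`S`-idèle class formation `(G_S, C̄_S)` at `W = V̄_L = layerSubgroupS S L` (`L ⊆ K_S`), for an ABSTRACT invariant map `inv`
satisfying `hinv` at every layer `E ⊇ L` inside `K_S` (the conclusion of bsd-line-x1-p1-w5's `invAt_classBarSD_inflG`, i.e.
`inv = invAt (classBarSD K S) inv_S V̄_L`).  Sequel to this seat's `IdeleClassBarSModAlphaOneInjective` (§1–§2 there: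
`galTraceQuotEquivS`, `galCharacterS`, `traceCharacterS`, `inv_inflG_eq_classInvAll_baseCup_of_hinv`), to
`GlobalReciprocityBidualityUnramifiedLayers` (`exists_idele_forall_unramified_layer_pairing_eq`: over the base `L`, every
additive family `Φ_{K'}` on the `ℤ/m`-characters of the finite abelian `K' ⊆ L̄` UNRAMIFIED OUTSIDE the places `T` above `S`,
compatible under THE restrictions `Γ_L → Gal(K'/L)`, is `χ ↦ −inv_{K'/L}(ι[x] ∪ β_m[χ])` for ONE idèle `x`) and to
`RestrictedRamificationLayerEmbedding` (`GalLayer.exists_ge_insideKS_nonempty_algHom`,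
`exists_isAbelianGalois_unramified_character_factor`).  One definition with body (`layerCharClassS`, the S-version of the
template's `layerCharClass`) and theorems; no named fact, no instance, no notation, no `sorry`.

* §1 `traceCharacterS_galCharacterS`, `traceCharacterS_add` (the character dictionary of the injectivity file is a bijection,
  additive).
* §2 `U_L = Gal(K̄/L) ↠ V̄_L = Gal(K_S/L)`: `mk_coe_mem_layerSubgroupS`, `exists_mk_coe_eq`, and
  **`galTraceQuotEquivS_symm_mk_mk`**: `g_S⁻¹ [[u]] = g⁻¹ [u]` in `Gal(M/L)` — so the template's transport
  `absRestrictNormalHom_absGalEquiv` (`(u|_M)|_{K'} = (θ u θ⁻¹)|_{K'}`) applies to the characters of the S-trace layers.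
* §3 **`layerCharClassS S h hM ψ χ_{K'}`** — the class in `Ext¹_{C_{V̄_L}}(ℤ, ℤ/m)` of a character `χ_{K'}` of a normal `K'/L`
  embedded by `ψ` into a layer `M ⊇ L`, `M ⊆ K_S`: additive, `m`-torsion under every functional, independent of `(M, ψ)` and
  equal for characters agreeing on `Γ_L` (`layerCharClassS_eq_of_forall_absRestrictNormalHom`), and `inflTriv (E⁻¹ χ) =
  layerCharClassS` when `χ ∘ g_S = χ_{K'} ∘ res` (`inflTriv_eq_layerCharClassS`).
* §4 `classInvAll_baseCup_eq_layerValue_of_factor_S`: at a layer `E ⊇ L` inside `K_S`, `inv_{K'/L}(ι[x₀] ∪ β_m[χ_{K'}])` is the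
  layer pairing value of `φ` (`φ(1) = [x₀]`) at `χ` when `χ ∘ g_S = χ_{K'} ∘ res` (door-c6 `classInvAll_baseCup_bockstein_comp` +
  the injectivity file's §2) — no `E ≠ L` case split is needed in the `S`-currency.
* §5 `apply_inflTriv_eq_layerValue_S` and **`exists_hom_forall_layer_value_eq_S`** — MILNE'S (b), SURJECTIVITY, for
  `(↥V̄_L, Res C̄_S)`: for every additive `Ψ : Ext¹_{C_{V̄_L}}(ℤ, ℤ/m) → ℚ/ℤ` there is `φ : ℤ ⟶ Res_{V̄_L} C̄_S` with
  `Ψ (inflTriv (E⁻¹ χ)) = inv (Inf (H²(id, φ_V) (β_m χ)))` for every layer `E ⊇ L` inside `K_S` and every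
  `χ ∈ H¹(↥V̄_L ⧸ (V̄_E ∩ V̄_L), ℤ/m)` — the hypothesis `Hsurj` of door-c4 g16's `adjointSurjective_triv_zmod_of_cofinal` on the
  cofinal family of S-trace layers.  The functional `Φ_{K'} χ := −m·Ψ(layerCharClassS)` on the characters of the finite abelian
  `K' ⊆ L̄` unramified outside `T` is additive and compatible, so global class field theory with restricted ramification over
  the base `L` (`exists_idele_forall_unramified_layer_pairing_eq`) supplies the idèle `x₀`, and `φ` is the invariant vector
  `[x₀] ∈ C̄_S^{V̄_L}` (door-c4 `homTrivEquiv`).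

Cell `bsd-eis`, background lane «PT-Ш-S-TC» of crux `GoodLatticeBDPValue` (stmt-BirchSwinnertonDyer-19032), brick D2-(b)
(`adjointBijective_one_zmod_pow` for `(G_S, C̄_S)`), seat bsd-line-x1-p1-w8 g13.  HONEST FRAMING: this is the `Hsurj` input of
door-c4 g16's `adjointBijective_triv_zmod_of_cofinal` for the `S`-idèle class formation (Milne ADT I Thm. 1.8 (b) = Harari
Prop. 15.42 (a) at every layer); no duality theorem, no case of Poitou–Tate and no case of BSD is proved here.

## References
* J. S. Milne, *Arithmetic Duality Theorems* (2nd ed. 2006), I §1 Lemma 1.7, Theorem 1.8 (b); I §4. [MilneADT2006]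
* D. Harari, *Galois Cohomology and Class Field Theory*, Universitext (2020), Prop. 15.42 (a), §17.1 Theorem 17.2. [Harari2020]
* J. W. S. Cassels, A. Fröhlich (eds.), *Algebraic Number Theory* (1967), Ch. VII (J. Tate) §5.1 (D), §11.1, §11.3.
  [CasselsFrohlichANT1967]
* J.-P. Serre, *Local Fields*, GTM 67 (1979), XI §1. [Serre1979]
* J. Neukirch, *Algebraic Number Theory* (1999), Ch. II (7.2)–(7.3). [NeukirchANT1999]
* K. S. Brown, *Cohomology of Groups* (1982), III §8. [Brown1982CohomologyGroups]
-/

noncomputable section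

open NumberField IsDedekindDomain CategoryTheory CategoryTheory.Limits groupCohomology
open Field (absoluteGaloisGroup)
open Literature.NumberTheory.Automorphic Literature.NumberTheory.Automorphic.IdeleClassGroup
open Literature.NumberTheory.NumberFields
open Literature.Algebra.Homology Literature.Algebra.Homology.DiscreteRep
open Literature.NumberTheory.GaloisRepresentations.LocalWeilDatum (galFixing)
open Literature.AnabelianGeometry.AbsoluteAnabelian.Prop121vii (zmodToQmodZ zmodToQmodZ_injective)
open scoped Classical

namespace Literature.NumberTheory.GaloisRepresentations

namespace IdeleClassBar

variable {K : Type} [Field K] [NumberField K] (S : Finset (HeightOneSpectrum (𝓞 K))) {L E M M' : GalLayer K}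

/-! ## §1. `traceCharacterS` is inverse to `galCharacterS` and additive -/

/-- `traceCharacterS (galCharacterS χ) = χ`: every class of `H¹(↥V̄_L ⧸ (V̄_E ∩ V̄_L), ℤ/m)` is the class of its character
`χ ∘ g_S` of `Gal(E/L)`. [cite: Brown1982CohomologyGroups, III §8] -/
theorem traceCharacterS_galCharacterS (h : L ≤ E) (hE : ramificationSubgroup K (↑S : Set (HeightOneSpectrum
    (𝓞 K))) ≤ galFixing K E.1) {m : ℕ} (χ : groupCohomology (Rep.trivial ℤ ((layerSubgroupS S L : Subgroup
    (GaloisGroupUnramifiedOutside K (↑S : Set (HeightOneSpectrum (𝓞 K))))) ⧸ (DiscreteRep.traceOpenNormalSubgroup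
    (layerSubgroupS S L : Subgroup (GaloisGroupUnramifiedOutside K (↑S : Set (HeightOneSpectrum (𝓞 K)))))
    (layerSubgroupS S E) : Subgroup (layerSubgroupS S L : Subgroup (GaloisGroupUnramifiedOutside K (↑S : Set
    (HeightOneSpectrum (𝓞 K))))))) (ZMod m)) 1) :
    traceCharacterS S h hE (galCharacterS S h hE χ) = χ := by
  rw [traceCharacterS, galCharacterS, AddMonoidHom.comp_assoc]
  have hcomp : (MonoidHom.toAdditive (galToTraceQuotS S h hE)).comp
      (MonoidHom.toAdditive (galTraceQuotEquivS S h hE).symm.toMonoidHom) = AddMonoidHom.id _ :=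
    AddMonoidHom.ext fun q => by
      change Additive.ofMul (galToTraceQuotS S h hE ((galTraceQuotEquivS S h hE).symm (Additive.toMul q))) = q
      rw [← galTraceQuotEquivS_apply, MulEquiv.apply_symm_apply]
      rfl
  rw [hcomp, AddMonoidHom.comp_id, Iso.hom_inv_id_apply]

/-- `traceCharacterS` is additive. [cite: Brown1982CohomologyGroups, III §8] -/
theorem traceCharacterS_add (h : L ≤ E) (hE : ramificationSubgroup K (↑S : Set (HeightOneSpectrum
    (𝓞 K))) ≤ galFixing K E.1) {m : ℕ} (χ₀ χ₀' : Additive (letI := GalLayer.algebraOfLE h;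
    (E.1 ≃ₐ[L.1] E.1)) →+ ZMod m) :
    traceCharacterS S h hE (χ₀ + χ₀') = traceCharacterS S h hE χ₀ + traceCharacterS S h hE χ₀' :=
  (congrArg (fun c => (H1IsoOfIsTrivial (Rep.trivial ℤ ((layerSubgroupS S L : Subgroup (GaloisGroupUnramifiedOutside K
      (↑S : Set (HeightOneSpectrum (𝓞 K))))) ⧸ (DiscreteRep.traceOpenNormalSubgroup (layerSubgroupS S L : Subgroup
      (GaloisGroupUnramifiedOutside K (↑S : Set (HeightOneSpectrum (𝓞 K))))) (layerSubgroupS S E) : Subgroup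
      (layerSubgroupS S L : Subgroup (GaloisGroupUnramifiedOutside K (↑S : Set (HeightOneSpectrum (𝓞 K)))))))
      (ZMod m))).inv c)
    (AddMonoidHom.add_comp χ₀ χ₀' (MonoidHom.toAdditive (galTraceQuotEquivS S h hE).symm.toMonoidHom))).trans
    (map_add _ _ _)

/-! ## §2. `U_L = Gal(K̄/L) ↠ V̄_L = Gal(K_S/L)` and `g_S⁻¹ [[u]] = g⁻¹ [u]` -/

omit [NumberField K] in
/-- `[u] ∈ V̄_L` for `u ∈ U_L = Gal(K̄/L)` (`galFixing K L = U_L` definitionally).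
[cite: NeukirchSchmidtWingberg2008, VIII §3][cite: SerreGaloisCohomology1997, I §2.2 Proposition 8] -/
theorem mk_coe_mem_layerSubgroupS (u : (L.openNormalSubgroup : Subgroup (absoluteGaloisGroup K))) :
    (QuotientGroup.mk (u : absoluteGaloisGroup K) : GaloisGroupUnramifiedOutside K (↑S : Set (HeightOneSpectrum
        (𝓞 K)))) ∈ (layerSubgroupS S L : Subgroup (GaloisGroupUnramifiedOutside K (↑S : Set (HeightOneSpectrum
        (𝓞 K))))) :=
  mk_mem_layerSubgroupS S L u.2

omit [NumberField K] in
/-- **Every element of `V̄_L = Gal(K_S/L)` is `[u]` for some `u ∈ U_L = Gal(K̄/L)`** (`V̄_L` is the image of `U_L`).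
[cite: SerreGaloisCohomology1997, I §2.2 Proposition 8] -/
theorem exists_mk_coe_eq (w : (layerSubgroupS S L : Subgroup (GaloisGroupUnramifiedOutside K (↑S : Set
    (HeightOneSpectrum (𝓞 K)))))) :
    ∃ u : (L.openNormalSubgroup : Subgroup (absoluteGaloisGroup K)), (⟨QuotientGroup.mk
        (u : absoluteGaloisGroup K), mk_coe_mem_layerSubgroupS S u⟩ : (layerSubgroupS S L : Subgroup
        (GaloisGroupUnramifiedOutside K (↑S : Set (HeightOneSpectrum (𝓞 K)))))) = w := by
  obtain ⟨σ, hσ, hw⟩ := (mem_layerSubgroupS_iff S L (w : GaloisGroupUnramifiedOutside K (↑S : Set (HeightOneSpectrum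
      (𝓞 K))))).1 w.2
  exact ⟨⟨σ, hσ⟩, Subtype.ext hw⟩

/-- **`g_S⁻¹ [[u]] = g⁻¹ [u]` in `Gal(M/L)`** for `u ∈ U_L` and a layer `M ⊇ L` inside `K_S`: the `L`-automorphism of `M`
attached to `[[u]] ∈ ↥V̄_L ⧸ (V̄_M ∩ V̄_L)` by the injectivity file's `g_S` is the one attached to `[u] ∈ U_L ⧸ (U_M ∩ U_L)` by
door-c4 g16's `g` — both act on `M ⊆ K̄` as `u` (template `coe_galTraceQuotEquiv_symm_mk_apply`).
[cite: Serre1979, XI §1 (iv)][cite: SerreGaloisCohomology1997, I §2.2 Proposition 8] -/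
theorem galTraceQuotEquivS_symm_mk_mk (h : L ≤ M) (hM : ramificationSubgroup K (↑S : Set (HeightOneSpectrum
    (𝓞 K))) ≤ galFixing K M.1) (u : (L.openNormalSubgroup : Subgroup (absoluteGaloisGroup K))) :
    (galTraceQuotEquivS S h hM).symm
        (QuotientGroup.mk (⟨QuotientGroup.mk (u : absoluteGaloisGroup K), mk_coe_mem_layerSubgroupS S u⟩ :
            (layerSubgroupS S L : Subgroup (GaloisGroupUnramifiedOutside K (↑S : Set (HeightOneSpectrum (𝓞 K))))))) =
      (galTraceQuotEquiv h).symm (QuotientGroup.mk u) := by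
  letI := GalLayer.algebraOfLE h
  have h1 : galResHom h ((galTraceQuotEquivS S h hM).symm
      (QuotientGroup.mk (⟨QuotientGroup.mk (u : absoluteGaloisGroup K), mk_coe_mem_layerSubgroupS S u⟩ :
          (layerSubgroupS S L : Subgroup (GaloisGroupUnramifiedOutside K (↑S : Set (HeightOneSpectrum (𝓞 K)))))))) =
      M.restrictHom (u : absoluteGaloisGroup K) := by
    change galResHom h ((galEquivSubgroupImage h).symm (traceQuotEquivSubgroupImage S L hM
      (QuotientGroup.mk (⟨QuotientGroup.mk (u : absoluteGaloisGroup K), mk_coe_mem_layerSubgroupS S u⟩ :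
          (layerSubgroupS S L : Subgroup (GaloisGroupUnramifiedOutside K (↑S : Set (HeightOneSpectrum
          (𝓞 K))))))))) = _
    rw [← coe_galEquivSubgroupImage h, MulEquiv.apply_symm_apply, coe_traceQuotEquivSubgroupImage_mk]
    exact restrictHomS_mk S hM _
  refine AlgEquiv.ext fun x => Subtype.ext (Eq.trans ?_ (coe_galTraceQuotEquiv_symm_mk_apply h u x).symm)
  have h2 := congrArg (fun τ : M.1 ≃ₐ[K] M.1 => ((τ x : M.1) : AlgebraicClosure K)) h1
  rw [GalLayer.coe_restrictHom_apply] at h2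
  exact h2

/-! ## §3. The inflated class of a character of `K'` embedded in a layer `M ⊇ L` inside `K_S` -/

/-- **The class in `Ext¹_{C_{V̄_L}}(ℤ, ℤ/m)` of a character `χ_{K'} : Gal(K'/L) → ℤ/m` of a normal `K'/L` embedded over `L` into
a layer `M ⊇ L`, `M ⊆ K_S`, by `ψ`**: the inflation from the trace layer `↥V̄_L ⧸ (V̄_M ∩ V̄_L) ≅ Gal(M/L)` of the class of
`χ_{K'} ∘ res_{K'} : Gal(M/L) → ℤ/m` (the injectivity file's `traceCharacterS`, door-c4 `inflTriv`); the S-version of the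
template's `layerCharClass`. [cite: MilneADT2006, I Theorem 1.8 (b)][cite: CasselsFrohlichANT1967, Ch. VII §11.1] -/
def layerCharClassS (h : L ≤ M) (hM : ramificationSubgroup K (↑S : Set (HeightOneSpectrum
    (𝓞 K))) ≤ galFixing K M.1) {K' : Type} [Field K'] [Algebra L.1 K'] [Normal L.1 K']
    (ψ : letI := GalLayer.algebraOfLE h; K' →ₐ[L.1] M.1) {m : ℕ} (χK : Additive (K' ≃ₐ[L.1] K') →+ ZMod m) :
    Abelian.Ext ((infFunctor ℤ (DiscreteRep.traceOpenNormalSubgroup (layerSubgroupS S L : Subgroup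
        (GaloisGroupUnramifiedOutside K (↑S : Set (HeightOneSpectrum (𝓞 K))))) (layerSubgroupS S M) : Subgroup
        (layerSubgroupS S L : Subgroup (GaloisGroupUnramifiedOutside K (↑S : Set (HeightOneSpectrum (𝓞 K))))))
        (LayerColimit.coe_isOpen _)).obj (Rep.trivial ℤ _ ℤ)) (triv (k := ℤ) (Γ := (layerSubgroupS S L : Subgroup
        (GaloisGroupUnramifiedOutside K (↑S : Set (HeightOneSpectrum (𝓞 K)))))) (ZMod m)) 1 :=
  letI := GalLayer.algebraOfLE h
  letI : Algebra K' M.1 := ψ.toRingHom.toAlgebra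
  haveI : IsScalarTower L.1 K' M.1 := IsScalarTower.of_algebraMap_eq fun r => (ψ.commutes r).symm
  inflTriv (DiscreteRep.traceOpenNormalSubgroup (layerSubgroupS S L : Subgroup (GaloisGroupUnramifiedOutside K
      (↑S : Set (HeightOneSpectrum (𝓞 K))))) (layerSubgroupS S M) : Subgroup (layerSubgroupS S L : Subgroup
      (GaloisGroupUnramifiedOutside K (↑S : Set (HeightOneSpectrum (𝓞 K)))))) (LayerColimit.coe_isOpen _)
          ((RepExt.extTrivialAddEquivGroupCohomology (Rep.trivial ℤ ((layerSubgroupS S L : Subgroup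
              (GaloisGroupUnramifiedOutside K (↑S : Set (HeightOneSpectrum (𝓞 K))))) ⧸
              (DiscreteRep.traceOpenNormalSubgroup (layerSubgroupS S L : Subgroup (GaloisGroupUnramifiedOutside K
              (↑S : Set (HeightOneSpectrum (𝓞 K))))) (layerSubgroupS S M) : Subgroup (layerSubgroupS S L : Subgroup
              (GaloisGroupUnramifiedOutside K (↑S : Set (HeightOneSpectrum (𝓞 K))))))) (ZMod m)) 1).symm
              (traceCharacterS S h hM (χK.comp (MonoidHom.toAdditive (AlgEquiv.restrictNormalHom K')))))

/-- Formula. [cite: MilneADT2006, I Theorem 1.8 (b)] -/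
theorem layerCharClassS_def (h : L ≤ M) (hM : ramificationSubgroup K (↑S : Set (HeightOneSpectrum
    (𝓞 K))) ≤ galFixing K M.1) {K' : Type} [Field K'] [Algebra L.1 K'] [Normal L.1 K']
    (ψ : letI := GalLayer.algebraOfLE h; K' →ₐ[L.1] M.1) {m : ℕ} (χK : Additive (K' ≃ₐ[L.1] K') →+ ZMod m) :
    layerCharClassS S h hM ψ χK =
      letI := GalLayer.algebraOfLE h
      letI : Algebra K' M.1 := ψ.toRingHom.toAlgebra
      haveI : IsScalarTower L.1 K' M.1 := IsScalarTower.of_algebraMap_eq fun r => (ψ.commutes r).symm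
      inflTriv (DiscreteRep.traceOpenNormalSubgroup (layerSubgroupS S L : Subgroup (GaloisGroupUnramifiedOutside K
          (↑S : Set (HeightOneSpectrum (𝓞 K))))) (layerSubgroupS S M) : Subgroup (layerSubgroupS S L : Subgroup
          (GaloisGroupUnramifiedOutside K (↑S : Set (HeightOneSpectrum (𝓞 K)))))) (LayerColimit.coe_isOpen _)
          ((RepExt.extTrivialAddEquivGroupCohomology (Rep.trivial ℤ ((layerSubgroupS S L : Subgroup
              (GaloisGroupUnramifiedOutside K (↑S : Set (HeightOneSpectrum (𝓞 K))))) ⧸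
              (DiscreteRep.traceOpenNormalSubgroup (layerSubgroupS S L : Subgroup (GaloisGroupUnramifiedOutside K
              (↑S : Set (HeightOneSpectrum (𝓞 K))))) (layerSubgroupS S M) : Subgroup (layerSubgroupS S L : Subgroup
              (GaloisGroupUnramifiedOutside K (↑S : Set (HeightOneSpectrum (𝓞 K))))))) (ZMod m)) 1).symm
              (traceCharacterS S h hM (χK.comp (MonoidHom.toAdditive (AlgEquiv.restrictNormalHom K'))))) :=
  rfl

set_option maxHeartbeats 800000 in
-- three elaborations of the restriction character `res_{K'}` over the layer tower (instance-heavy)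
/-- `layerCharClassS` is additive in the character. [cite: MilneADT2006, I Theorem 1.8 (b)] -/
theorem layerCharClassS_add (h : L ≤ M) (hM : ramificationSubgroup K (↑S : Set (HeightOneSpectrum
    (𝓞 K))) ≤ galFixing K M.1) {K' : Type} [Field K'] [Algebra L.1 K'] [Normal L.1 K']
    (ψ : letI := GalLayer.algebraOfLE h; K' →ₐ[L.1] M.1) {m : ℕ} (χK χK' : Additive (K' ≃ₐ[L.1] K') →+ ZMod m) :
    layerCharClassS S h hM ψ (χK + χK') = layerCharClassS S h hM ψ χK + layerCharClassS S h hM ψ χK' := by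
  letI := GalLayer.algebraOfLE h
  letI : Algebra K' M.1 := ψ.toRingHom.toAlgebra
  haveI : IsScalarTower L.1 K' M.1 := IsScalarTower.of_algebraMap_eq fun r => (ψ.commutes r).symm
  have e₁ : traceCharacterS S h hM ((χK + χK').comp (MonoidHom.toAdditive (AlgEquiv.restrictNormalHom K'))) =
      traceCharacterS S h hM (χK.comp (MonoidHom.toAdditive (AlgEquiv.restrictNormalHom K'))) +
        traceCharacterS S h hM (χK'.comp (MonoidHom.toAdditive (AlgEquiv.restrictNormalHom K'))) :=
    (congrArg (traceCharacterS S h hM) (AddMonoidHom.add_comp χK χK' _)).trans (traceCharacterS_add S h hM _ _)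
  have e₂ := (congrArg (fun c => (RepExt.extTrivialAddEquivGroupCohomology (Rep.trivial ℤ
      ((layerSubgroupS S L : Subgroup (GaloisGroupUnramifiedOutside K (↑S : Set (HeightOneSpectrum (𝓞 K))))) ⧸
      (DiscreteRep.traceOpenNormalSubgroup (layerSubgroupS S L : Subgroup (GaloisGroupUnramifiedOutside K (↑S : Set
      (HeightOneSpectrum (𝓞 K))))) (layerSubgroupS S M) : Subgroup (layerSubgroupS S L : Subgroup
      (GaloisGroupUnramifiedOutside K (↑S : Set (HeightOneSpectrum (𝓞 K))))))) (ZMod m)) 1).symm c)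
    e₁).trans (map_add (RepExt.extTrivialAddEquivGroupCohomology (Rep.trivial ℤ ((layerSubgroupS S L : Subgroup
        (GaloisGroupUnramifiedOutside K (↑S : Set (HeightOneSpectrum (𝓞 K))))) ⧸ (DiscreteRep.traceOpenNormalSubgroup
        (layerSubgroupS S L : Subgroup (GaloisGroupUnramifiedOutside K (↑S : Set (HeightOneSpectrum (𝓞 K)))))
        (layerSubgroupS S M) : Subgroup (layerSubgroupS S L : Subgroup (GaloisGroupUnramifiedOutside K (↑S : Set
        (HeightOneSpectrum (𝓞 K))))))) (ZMod m)) 1).symm _ _)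
  exact (congrArg (fun y => inflTriv (k := ℤ) (X := ℤ) (Y := ZMod m) (DiscreteRep.traceOpenNormalSubgroup
      (layerSubgroupS S L : Subgroup (GaloisGroupUnramifiedOutside K (↑S : Set (HeightOneSpectrum (𝓞 K)))))
      (layerSubgroupS S M) : Subgroup (layerSubgroupS S L : Subgroup (GaloisGroupUnramifiedOutside K (↑S : Set
      (HeightOneSpectrum (𝓞 K)))))) (LayerColimit.coe_isOpen _) y) e₂).trans
    (inflTriv_add _ _ _ _)

/-- **`m • Ψ (layerCharClassS h hM ψ χ_{K'}) = 0`** for every additive `Ψ` (the class is that of a `ℤ/m`-character).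
[cite: MilneADT2006, I Lemma 1.7] -/
theorem nsmul_apply_layerCharClassS_eq_zero (h : L ≤ M) (hM : ramificationSubgroup K (↑S : Set (HeightOneSpectrum
    (𝓞 K))) ≤ galFixing K M.1) {K' : Type} [Field K']
    [Algebra L.1 K'] [Normal L.1 K'] (ψ : letI := GalLayer.algebraOfLE h; K' →ₐ[L.1] M.1) {m : ℕ}
    (χK : Additive (K' ≃ₐ[L.1] K') →+ ZMod m) {Q : Type} [AddCommGroup Q]
    (Ψ : Abelian.Ext (triv (k := ℤ) (Γ := (layerSubgroupS S L : Subgroup (GaloisGroupUnramifiedOutside K (↑S : Set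
        (HeightOneSpectrum (𝓞 K)))))) ℤ) (triv (k := ℤ) (Γ := (layerSubgroupS S L : Subgroup
        (GaloisGroupUnramifiedOutside K (↑S : Set (HeightOneSpectrum (𝓞 K)))))) (ZMod m)) 1 →+ Q) :
    m • Ψ (layerCharClassS S h hM ψ χK) = 0 :=
  nsmul_apply_inflTriv_H1IsoOfIsTrivial_inv_eq_zero Ψ _ _

/-- **`layerCharClassS` only depends on the character `w ↦ χ_{K'}((g_S⁻¹ [w])|_{K'})` of `V̄_L`**: two characters `χ_{K'}`,
`χ_{K''}` of normal `K', K''` embedded into layers `M, M' ⊇ L` inside `K_S` with `χ_{K'}((g_S⁻¹[w])|_{K'}) =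
χ_{K''}((g_S'⁻¹[w])|_{K''})` for all `w ∈ V̄_L` have the same class (door-c4 g17 `inflTriv_H1IsoOfIsTrivial_inv_eq_of_forall`).
[cite: SerreGaloisCohomology1997, I §2.2 Proposition 8][cite: MilneADT2006, I Theorem 1.8 (b)] -/
theorem layerCharClassS_eq_of_forall (h : L ≤ M) (h' : L ≤ M') (hM : ramificationSubgroup K (↑S : Set
    (HeightOneSpectrum (𝓞 K))) ≤ galFixing K M.1)
    (hM' : ramificationSubgroup K (↑S : Set (HeightOneSpectrum (𝓞 K))) ≤ galFixing K M'.1) {K' K'' : Type} [Field K']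
        [Algebra L.1 K'] [Normal L.1 K'] [Field K'']
    [Algebra L.1 K''] [Normal L.1 K'']
    (ψ : letI := GalLayer.algebraOfLE h; K' →ₐ[L.1] M.1)
        (ψ' : letI := GalLayer.algebraOfLE h'; K'' →ₐ[L.1] M'.1) {m : ℕ}
    (χK : Additive (K' ≃ₐ[L.1] K') →+ ZMod m) (χK' : Additive (K'' ≃ₐ[L.1] K'') →+ ZMod m)
    (H : ∀ w : (layerSubgroupS S L : Subgroup (GaloisGroupUnramifiedOutside K (↑S : Set (HeightOneSpectrum (𝓞 K))))),
      (letI := GalLayer.algebraOfLE h; letI : Algebra K' M.1 := ψ.toRingHom.toAlgebra;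
        haveI : IsScalarTower L.1 K' M.1 := IsScalarTower.of_algebraMap_eq fun r => (ψ.commutes r).symm;
        χK (Additive.ofMul (AlgEquiv.restrictNormalHom K' ((galTraceQuotEquivS S h hM).symm (QuotientGroup.mk w))))) =
      (letI := GalLayer.algebraOfLE h'; letI : Algebra K'' M'.1 := ψ'.toRingHom.toAlgebra;
        haveI : IsScalarTower L.1 K'' M'.1 := IsScalarTower.of_algebraMap_eq fun r => (ψ'.commutes r).symm;
        χK' (Additive.ofMul (AlgEquiv.restrictNormalHom K'' ((galTraceQuotEquivS S h' hM').symm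
            (QuotientGroup.mk w)))))) :
    layerCharClassS S h hM ψ χK = layerCharClassS S h' hM' ψ' χK' := by
  delta layerCharClassS traceCharacterS
  exact inflTriv_H1IsoOfIsTrivial_inv_eq_of_forall _ _ _ _ fun w => H w

/-- **`inflTriv (E⁻¹ χ) = layerCharClassS h hE ψ χ_{K'}`** when the character `χ ∘ g_S` of `Gal(E/L)` factors as
`χ_{K'} ∘ res_{K'}` through `ψ : K' → E`. [cite: MilneADT2006, I Theorem 1.8 (b)] -/
theorem inflTriv_eq_layerCharClassS (h : L ≤ E) (hE : ramificationSubgroup K (↑S : Set (HeightOneSpectrum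
    (𝓞 K))) ≤ galFixing K E.1) {K' : Type} [Field K'] [Algebra L.1 K']
    [Normal L.1 K'] (ψ : letI := GalLayer.algebraOfLE h; K' →ₐ[L.1] E.1) {m : ℕ} (χK : Additive
        (K' ≃ₐ[L.1] K') →+ ZMod m)
    (χ : groupCohomology (Rep.trivial ℤ ((layerSubgroupS S L : Subgroup (GaloisGroupUnramifiedOutside K (↑S : Set
        (HeightOneSpectrum (𝓞 K))))) ⧸ (DiscreteRep.traceOpenNormalSubgroup (layerSubgroupS S L : Subgroup
        (GaloisGroupUnramifiedOutside K (↑S : Set (HeightOneSpectrum (𝓞 K))))) (layerSubgroupS S E) : Subgroup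
        (layerSubgroupS S L : Subgroup (GaloisGroupUnramifiedOutside K (↑S : Set (HeightOneSpectrum (𝓞 K)))))))
        (ZMod m)) 1)
    (hfac : letI := GalLayer.algebraOfLE h; letI : Algebra K' E.1 := ψ.toRingHom.toAlgebra;
      haveI : IsScalarTower L.1 K' E.1 := IsScalarTower.of_algebraMap_eq fun r => (ψ.commutes r).symm;
      galCharacterS S h hE χ = χK.comp (MonoidHom.toAdditive (AlgEquiv.restrictNormalHom K'))) :
    inflTriv (DiscreteRep.traceOpenNormalSubgroup (layerSubgroupS S L : Subgroup (GaloisGroupUnramifiedOutside K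
        (↑S : Set (HeightOneSpectrum (𝓞 K))))) (layerSubgroupS S E) : Subgroup (layerSubgroupS S L : Subgroup
        (GaloisGroupUnramifiedOutside K (↑S : Set (HeightOneSpectrum (𝓞 K)))))) (LayerColimit.coe_isOpen _)
          ((RepExt.extTrivialAddEquivGroupCohomology (Rep.trivial ℤ ((layerSubgroupS S L : Subgroup
              (GaloisGroupUnramifiedOutside K (↑S : Set (HeightOneSpectrum (𝓞 K))))) ⧸
              (DiscreteRep.traceOpenNormalSubgroup (layerSubgroupS S L : Subgroup (GaloisGroupUnramifiedOutside K
              (↑S : Set (HeightOneSpectrum (𝓞 K))))) (layerSubgroupS S E) : Subgroup (layerSubgroupS S L : Subgroup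
              (GaloisGroupUnramifiedOutside K (↑S : Set (HeightOneSpectrum (𝓞 K))))))) (ZMod m)) 1).symm χ) =
      layerCharClassS S h hE ψ χK := by
  rw [layerCharClassS_def, ← hfac, traceCharacterS_galCharacterS]

set_option synthInstance.maxHeartbeats 100000 in
set_option maxHeartbeats 800000 in
-- instance synthesis over `K' ⊆ L̄` (an intermediate field of the algebraic closure of a layer) is slow (template §41)
/-- **The class of `(K', χ_{K'})` does not depend on the layer inside `K_S` and the embedding, and agrees for compatible
characters**: for finite ABELIAN `K', K'' ⊆ L̄` embedded in layers `M, M' ⊇ L` inside `K_S` and characters with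
`χ_{K'}(γ|_{K'}) = χ_{K''}(γ|_{K''})` for all `γ ∈ Γ_L` (THE restrictions `absRestrictNormalHom`), the classes coincide: every
`w ∈ V̄_L` lifts to `u ∈ U_L` (§2), `g_S⁻¹[w] = g⁻¹[u]`, and `(g⁻¹[u])|_{K'} = (θ u θ⁻¹)|_{K'}` (door-c4 g17
`absRestrictNormalHom_absGalEquiv`). [cite: MilneADT2006, I Theorem 1.8 (b)][cite: CasselsFrohlichANT1967, Ch. VII §11.1]
[cite: Serre1979, XI §1] -/
theorem layerCharClassS_eq_of_forall_absRestrictNormalHom (h : L ≤ M) (h' : L ≤ M') (hM : ramificationSubgroup K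
    (↑S : Set (HeightOneSpectrum (𝓞 K))) ≤ galFixing K M.1)
    (hM' : ramificationSubgroup K (↑S : Set (HeightOneSpectrum (𝓞 K))) ≤ galFixing K M'.1)
    (K' K'' : IntermediateField L.1 (AlgebraicClosure L.1)) [IsAbelianGalois L.1 K'] [IsAbelianGalois L.1 K'']
    (ψ : letI := GalLayer.algebraOfLE h; K' →ₐ[L.1] M.1)
        (ψ' : letI := GalLayer.algebraOfLE h'; K'' →ₐ[L.1] M'.1) {m : ℕ}
    (χK : Additive (K' ≃ₐ[L.1] K') →+ ZMod m) (χK' : Additive (K'' ≃ₐ[L.1] K'') →+ ZMod m)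
    (hγ : ∀ γ : absoluteGaloisGroup L.1,
      χK (Additive.ofMul (absRestrictNormalHom K' γ)) = χK' (Additive.ofMul (absRestrictNormalHom K'' γ))) :
    layerCharClassS S h hM ψ χK = layerCharClassS S h' hM' ψ' χK' := by
  refine layerCharClassS_eq_of_forall S h h' hM hM' ψ ψ' χK χK' fun w => ?_
  obtain ⟨u, hu⟩ := exists_mk_coe_eq S w
  letI := GalLayer.algebraOfLE h
  letI : Algebra K' M.1 := ψ.toRingHom.toAlgebra
  haveI : IsScalarTower L.1 K' M.1 := IsScalarTower.of_algebraMap_eq fun r => (ψ.commutes r).symm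
  letI := GalLayer.algebraOfLE h'
  letI : Algebra K'' M'.1 := ψ'.toRingHom.toAlgebra
  haveI : IsScalarTower L.1 K'' M'.1 := IsScalarTower.of_algebraMap_eq fun r => (ψ'.commutes r).symm
  -- `(g_S⁻¹[[u]])|_{K'} = (g⁻¹[u])|_{K'} = (θ u θ⁻¹)|_{K'}` and the same for `K''`
  have e₁ := congrArg (fun τ => χK (Additive.ofMul τ)) (absRestrictNormalHom_absGalEquiv h u K' ψ)
  have e₂ := congrArg (fun τ => χK' (Additive.ofMul τ)) (absRestrictNormalHom_absGalEquiv h' u K'' ψ')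
  have f₁ := congrArg (fun σ => χK (Additive.ofMul (AlgEquiv.restrictNormalHom K' σ)))
    (galTraceQuotEquivS_symm_mk_mk S h hM u)
  have f₂ := congrArg (fun σ => χK' (Additive.ofMul (AlgEquiv.restrictNormalHom K'' σ)))
    (galTraceQuotEquivS_symm_mk_mk S h' hM' u)
  have g₁ := congrArg (fun v : (layerSubgroupS S L : Subgroup (GaloisGroupUnramifiedOutside K (↑S : Set
      (HeightOneSpectrum (𝓞 K))))) =>
    χK (Additive.ofMul (AlgEquiv.restrictNormalHom K' ((galTraceQuotEquivS S h hM).symm (QuotientGroup.mk v))))) hu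
  have g₂ := congrArg (fun v : (layerSubgroupS S L : Subgroup (GaloisGroupUnramifiedOutside K (↑S : Set
      (HeightOneSpectrum (𝓞 K))))) =>
    χK' (Additive.ofMul (AlgEquiv.restrictNormalHom K'' ((galTraceQuotEquivS S h' hM').symm
        (QuotientGroup.mk v))))) hu
  exact g₁.symm.trans ((f₁.trans (e₁.symm.trans ((hγ (L.absGalEquiv u)).trans (e₂.trans f₂.symm)))).trans g₂)

/-! ## §4. The final verification at a layer `E ⊇ L` inside `K_S` -/

set_option synthInstance.maxHeartbeats 100000 in
set_option maxHeartbeats 800000 in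
-- instance synthesis over `K' ⊆ L̄` and the big unfolded layer terms (as in the template's §41 and the injectivity file's §3)
/-- **At a layer `E ⊇ L` inside `K_S`: `inv_{K'/L}(ι[x₀] ∪ β_m[χ_{K'}]) =` the layer pairing value of `φ` at `χ`**, when
`χ ∘ g_S = χ_{K'} ∘ res_{K'}` for an abelian `K' ⊆ L̄` embedded by `ψ : K' → E` and `φ(1) = [x₀]` (door-c6's inflation
invariance `classInvAll_baseCup_bockstein_comp` and the injectivity file's `inv_inflG_eq_classInvAll_baseCup_of_hinv`; in the
`S`-currency the degenerate layer `E = L` needs no separate treatment).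
[cite: CasselsFrohlichANT1967, Ch. VII §11.2 (bis), §11.3][cite: MilneADT2006, I Theorem 1.8 (b)] -/
theorem classInvAll_baseCup_eq_layerValue_of_factor_S (h : L ≤ E)
    (hL : ramificationSubgroup K (↑S : Set (HeightOneSpectrum (𝓞 K))) ≤ galFixing K L.1) (hE : ramificationSubgroup K
        (↑S : Set (HeightOneSpectrum (𝓞 K))) ≤ galFixing K E.1)
    (hSE : ∀ v : HeightOneSpectrum (𝓞 K), v ∉ S → (haveI := E.numberField; Algebra.IsUnramifiedIn (𝓞 E.1) v.asIdeal))
    {m : ℕ} (hm : 0 < m) (inv : Abelian.Ext (triv (k := ℤ) (Γ := (layerSubgroupS S L : Subgroup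
        (GaloisGroupUnramifiedOutside K (↑S : Set (HeightOneSpectrum (𝓞 K)))))) ℤ) ((resD ℤ
        (layerSubgroupS S L : Subgroup (GaloisGroupUnramifiedOutside K (↑S : Set (HeightOneSpectrum (𝓞 K)))))).obj
        (classBarSD K S)) 2 →+ AddCircle (1 : ℚ))
    (hinv : ∀ x : groupCohomology (relLayerRepS S (layerSubgroupS S L : Subgroup (GaloisGroupUnramifiedOutside K
        (↑S : Set (HeightOneSpectrum (𝓞 K))))) E) 2,
      inv (LayerColimit.inflG (DiscreteRep.traceOpenNormalSubgroup (layerSubgroupS S L : Subgroup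
          (GaloisGroupUnramifiedOutside K (↑S : Set (HeightOneSpectrum (𝓞 K))))) (layerSubgroupS S E)) ((resD ℤ
          (layerSubgroupS S L : Subgroup (GaloisGroupUnramifiedOutside K (↑S : Set (HeightOneSpectrum (𝓞 K)))))).obj
          (classBarSD K S)) 2 x) =
        (haveI := E.numberField; haveI := E.isGalois; haveI := finite_gal K E;
          (IdeleCohomology.isClassModule_classModUnitsCocycle S hSE).invSub (subgroupImageS S hE
              (layerSubgroupS S L : Subgroup (GaloisGroupUnramifiedOutside K (↑S : Set (HeightOneSpectrum (𝓞 K))))))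
            ((relLayerSCohomologyIso S hE (layerSubgroupS_anti S h) 2).hom x)))
    (φ : triv (k := ℤ) (Γ := (layerSubgroupS S L : Subgroup (GaloisGroupUnramifiedOutside K (↑S : Set
        (HeightOneSpectrum (𝓞 K)))))) ℤ ⟶ ((resD ℤ (layerSubgroupS S L : Subgroup (GaloisGroupUnramifiedOutside K
        (↑S : Set (HeightOneSpectrum (𝓞 K)))))).obj (classBarSD K S)))
    (x₀ : haveI := L.numberField; ideleGroup L.1)
    (hx₀ : haveI := L.numberField; ofLayerS S hL (Additive.ofMul (x₀ : IdeleClassGroup L.1)) = φ.hom.hom (1 : ℤ))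
    (χ : groupCohomology (Rep.trivial ℤ ((layerSubgroupS S L : Subgroup (GaloisGroupUnramifiedOutside K (↑S : Set
        (HeightOneSpectrum (𝓞 K))))) ⧸ (DiscreteRep.traceOpenNormalSubgroup (layerSubgroupS S L : Subgroup
        (GaloisGroupUnramifiedOutside K (↑S : Set (HeightOneSpectrum (𝓞 K))))) (layerSubgroupS S E) : Subgroup
        (layerSubgroupS S L : Subgroup (GaloisGroupUnramifiedOutside K (↑S : Set (HeightOneSpectrum (𝓞 K)))))))
        (ZMod m)) 1)
    (K' : IntermediateField L.1 (AlgebraicClosure L.1))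
    (hK : FiniteDimensional L.1 K') (hab : IsAbelianGalois L.1 K')
    (ψ : letI := GalLayer.algebraOfLE h; K' →ₐ[L.1] E.1) (χK : Additive (K' ≃ₐ[L.1] K') →+ ZMod m)
    (hfac : letI := GalLayer.algebraOfLE h; letI : Algebra K' E.1 := ψ.toRingHom.toAlgebra;
      haveI : IsScalarTower L.1 K' E.1 := IsScalarTower.of_algebraMap_eq fun r => (ψ.commutes r).symm;
      galCharacterS S h hE χ = χK.comp (MonoidHom.toAdditive (AlgEquiv.restrictNormalHom K'))) :
    haveI := L.numberField; haveI : NumberField K' := NumberField.of_module_finite L.1 K'; haveI : NeZero m :=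
        ⟨hm.ne'⟩
    IdeleCohomology.classInvAll L.1 K' (IdeleCohomology.baseCup (E := K') x₀
      (groupCohomology.δ (Bockstein.intModShortComplex_shortExact (K' ≃ₐ[L.1] K') m) 1 2 rfl
        ((H1IsoOfIsTrivial (Rep.trivial ℤ (K' ≃ₐ[L.1] K') (ZMod m))).inv χK))) =
      inv (LayerColimit.inflG (DiscreteRep.traceOpenNormalSubgroup (layerSubgroupS S L : Subgroup
          (GaloisGroupUnramifiedOutside K (↑S : Set (HeightOneSpectrum (𝓞 K))))) (layerSubgroupS S E)) ((resD ℤ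
          (layerSubgroupS S L : Subgroup (GaloisGroupUnramifiedOutside K (↑S : Set (HeightOneSpectrum (𝓞 K)))))).obj
          (classBarSD K S)) 2
        (groupCohomology.map (MonoidHom.id _) (LayerColimit.homToLayer (DiscreteRep.traceOpenNormalSubgroup
            (layerSubgroupS S L : Subgroup (GaloisGroupUnramifiedOutside K (↑S : Set (HeightOneSpectrum (𝓞 K)))))
            (layerSubgroupS S E) : Subgroup (layerSubgroupS S L : Subgroup (GaloisGroupUnramifiedOutside K (↑S : Set
            (HeightOneSpectrum (𝓞 K)))))) ((resD ℤ (layerSubgroupS S L : Subgroup (GaloisGroupUnramifiedOutside K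
            (↑S : Set (HeightOneSpectrum (𝓞 K)))))).obj (classBarSD K S)) φ) 2
          (groupCohomology.δ (Bockstein.intModShortComplex_shortExact ((layerSubgroupS S L : Subgroup
              (GaloisGroupUnramifiedOutside K (↑S : Set (HeightOneSpectrum (𝓞 K))))) ⧸
              (DiscreteRep.traceOpenNormalSubgroup (layerSubgroupS S L : Subgroup (GaloisGroupUnramifiedOutside K
              (↑S : Set (HeightOneSpectrum (𝓞 K))))) (layerSubgroupS S E) : Subgroup (layerSubgroupS S L : Subgroup
              (GaloisGroupUnramifiedOutside K (↑S : Set (HeightOneSpectrum (𝓞 K))))))) m) 1 2 rfl χ))) := by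
  haveI : NeZero m := ⟨hm.ne'⟩
  haveI := L.numberField
  haveI := hK
  letI := GalLayer.algebraOfLE h
  haveI := GalLayer.isScalarTower_of_le h
  haveI := E.numberField
  haveI := E.isGalois
  haveI : IsGalois L.1 E.1 := IsGalois.tower_top_of_isGalois K L.1 E.1
  -- the layer fact (before the instances of `K' ⊆ L̄` enter the context)
  have hB3 := inv_inflG_eq_classInvAll_baseCup_of_hinv S h hL hE hSE hm inv hinv φ x₀ hx₀ χ
  haveI := hab
  haveI : NumberField K' := NumberField.of_module_finite L.1 K'
  letI : Algebra K' E.1 := ψ.toRingHom.toAlgebra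
  haveI : IsScalarTower L.1 K' E.1 := IsScalarTower.of_algebraMap_eq fun r => (ψ.commutes r).symm
  rw [← IdeleCohomology.classInvAll_baseCup_bockstein_comp L.1 K' E.1 m χK x₀]
  have hfac' : χK.comp (MonoidHom.toAdditive (AlgEquiv.restrictNormalHom (F := L.1) (K₁ := E.1) K')) =
      galCharacterS S h hE χ := hfac.symm
  rw [hfac']
  exact hB3.symm

/-! ## §5. Surjectivity: every additive functional on `Ext¹_{C_{V̄_L}}(ℤ, ℤ/m)` is represented by an invariant vector -/

/-- **`S`-unramified over `K` ⟹ `T`-unramified over `L`** for the set `T` of places of `L` above `S` (tower lemma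
`isUnramifiedIn_tower_top`). [cite: NeukirchANT1999, Ch. II (7.2)] -/
theorem forall_isUnramifiedIn_of_forall_under (T : haveI := L.numberField; Finset (HeightOneSpectrum (𝓞 L.1)))
    (hT : haveI := L.numberField; ∀ w : HeightOneSpectrum (𝓞 L.1), w ∈ T ↔ w.under (𝓞 K) ∈ S)
    (K' : Type) [Field K'] [NumberField K'] [Algebra L.1 K'] [Algebra K K'] [IsScalarTower K L.1 K']
    (hu : ∀ v : HeightOneSpectrum (𝓞 K), v ∉ (↑S : Set (HeightOneSpectrum (𝓞 K))) → Algebra.IsUnramifiedIn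
        (𝓞 K') v.asIdeal) :
    haveI := L.numberField; ∀ w : HeightOneSpectrum (𝓞 L.1), w ∉ T → Algebra.IsUnramifiedIn (𝓞 K') w.asIdeal := by
  haveI := L.numberField
  intro w hw
  refine isUnramifiedIn_tower_top (K := K) L.1 K' (hu (w.under (𝓞 K)) fun hv => hw ((hT w).2
      (Finset.mem_coe.1 hv))) w ?_
  rw [HeightOneSpectrum.under_asIdeal]
  infer_instance

set_option synthInstance.maxHeartbeats 100000 in
set_option maxHeartbeats 800000 in
-- the big unfolded layer terms (as in the template's §42)
/-- **The layer identity at `E ⊇ L` inside `K_S`, given the arithmetic input on the abelian layers.**  If the idèle `x₀` of `L`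
(with `φ(1) = [x₀]`) satisfies `Ψ(layerCharClassS) = inv_{K'/L}(ι[x₀] ∪ β_m[χ_{K'}])` for every finite abelian `K' ⊆ L̄` unramified
outside the places `T` above `S` and every `χ_{K'}` (classes taken through the chosen embeddings `ψof K' : K' → Mof K' ⊇ L`,
`Mof K' ⊆ K_S`), then `Ψ (inflTriv (E⁻¹ χ)) = inv (Inf (H²(id, φ_V) (β_m χ)))` for every `χ ∈ H¹(↥V̄_L ⧸ (V̄_E ∩ V̄_L), ℤ/m)`:
the character `χ ∘ g_S` factors through an `S`-unramified abelian `K' ⊆ L̄` embedded in `E`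
(`exists_isAbelianGalois_unramified_character_factor`), `inflTriv (E⁻¹ χ)` is the class of `(K', χ_{K'})` for EITHER embedding
(§3), and §4 applies. [cite: MilneADT2006, I Theorem 1.8 (b)][cite: CasselsFrohlichANT1967, Ch. VII §11.3]
[cite: NeukirchANT1999, Ch. II (7.2)–(7.3)] -/
theorem apply_inflTriv_eq_layerValue_S (h : L ≤ E)
    (hL : ramificationSubgroup K (↑S : Set (HeightOneSpectrum (𝓞 K))) ≤ galFixing K L.1) (hE : ramificationSubgroup K
        (↑S : Set (HeightOneSpectrum (𝓞 K))) ≤ galFixing K E.1)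
    (hSE : ∀ v : HeightOneSpectrum (𝓞 K), v ∉ S → (haveI := E.numberField; Algebra.IsUnramifiedIn (𝓞 E.1) v.asIdeal))
    {m : ℕ} (hm : 0 < m) (inv : Abelian.Ext (triv (k := ℤ) (Γ := (layerSubgroupS S L : Subgroup
        (GaloisGroupUnramifiedOutside K (↑S : Set (HeightOneSpectrum (𝓞 K)))))) ℤ) ((resD ℤ
        (layerSubgroupS S L : Subgroup (GaloisGroupUnramifiedOutside K (↑S : Set (HeightOneSpectrum (𝓞 K)))))).obj
        (classBarSD K S)) 2 →+ AddCircle (1 : ℚ))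
    (hinv : ∀ x : groupCohomology (relLayerRepS S (layerSubgroupS S L : Subgroup (GaloisGroupUnramifiedOutside K
        (↑S : Set (HeightOneSpectrum (𝓞 K))))) E) 2,
      inv (LayerColimit.inflG (DiscreteRep.traceOpenNormalSubgroup (layerSubgroupS S L : Subgroup
          (GaloisGroupUnramifiedOutside K (↑S : Set (HeightOneSpectrum (𝓞 K))))) (layerSubgroupS S E)) ((resD ℤ
          (layerSubgroupS S L : Subgroup (GaloisGroupUnramifiedOutside K (↑S : Set (HeightOneSpectrum (𝓞 K)))))).obj
          (classBarSD K S)) 2 x) =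
        (haveI := E.numberField; haveI := E.isGalois; haveI := finite_gal K E;
          (IdeleCohomology.isClassModule_classModUnitsCocycle S hSE).invSub (subgroupImageS S hE
              (layerSubgroupS S L : Subgroup (GaloisGroupUnramifiedOutside K (↑S : Set (HeightOneSpectrum (𝓞 K))))))
            ((relLayerSCohomologyIso S hE (layerSubgroupS_anti S h) 2).hom x)))
    (Ψ : Abelian.Ext (triv (k := ℤ) (Γ := (layerSubgroupS S L : Subgroup (GaloisGroupUnramifiedOutside K (↑S : Set
        (HeightOneSpectrum (𝓞 K)))))) ℤ) (triv (k := ℤ) (Γ := (layerSubgroupS S L : Subgroup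
        (GaloisGroupUnramifiedOutside K (↑S : Set (HeightOneSpectrum (𝓞 K)))))) (ZMod m)) 1 →+ AddCircle (1 : ℚ))
    (φ : triv (k := ℤ) (Γ := (layerSubgroupS S L : Subgroup (GaloisGroupUnramifiedOutside K (↑S : Set
        (HeightOneSpectrum (𝓞 K)))))) ℤ ⟶ ((resD ℤ (layerSubgroupS S L : Subgroup (GaloisGroupUnramifiedOutside K
        (↑S : Set (HeightOneSpectrum (𝓞 K)))))).obj (classBarSD K S)))
    (x₀ : haveI := L.numberField; ideleGroup L.1)
    (hx₀ : haveI := L.numberField; ofLayerS S hL (Additive.ofMul (x₀ : IdeleClassGroup L.1)) = φ.hom.hom (1 : ℤ))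
    (T : haveI := L.numberField; Finset (HeightOneSpectrum (𝓞 L.1)))
    (hT : haveI := L.numberField; ∀ w : HeightOneSpectrum (𝓞 L.1), w ∈ T ↔ w.under (𝓞 K) ∈ S)
    (Mof : haveI := L.numberField;
      ∀ (K' : IntermediateField L.1 (AlgebraicClosure L.1)), FiniteDimensional L.1 K' → IsGalois L.1 K' →
        (∀ w : HeightOneSpectrum (𝓞 L.1), w ∉ T → Algebra.IsUnramifiedIn (𝓞 K') w.asIdeal) → GalLayer K)
    (hMof : haveI := L.numberField; ∀ K' hK hG hu, L ≤ Mof K' hK hG hu)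
    (hMofS : haveI := L.numberField; ∀ K' hK hG hu, ramificationSubgroup K (↑S : Set (HeightOneSpectrum
        (𝓞 K))) ≤ galFixing K (Mof K' hK hG hu).1)
    (ψof : haveI := L.numberField;
      ∀ K' hK hG hu, letI := GalLayer.algebraOfLE (hMof K' hK hG hu); K' →ₐ[L.1] (Mof K' hK hG hu).1)
    (hΨ : haveI := L.numberField; haveI : NeZero m := ⟨hm.ne'⟩;
      ∀ (K' : IntermediateField L.1 (AlgebraicClosure L.1)) (hK : FiniteDimensional L.1 K')
          (hab : IsAbelianGalois L.1 K')
        (hu : ∀ w : HeightOneSpectrum (𝓞 L.1), w ∉ T → Algebra.IsUnramifiedIn (𝓞 K') w.asIdeal)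
        (χK : Additive (K' ≃ₐ[L.1] K') →+ ZMod m),
        haveI : NumberField K' := NumberField.of_module_finite L.1 K'
        Ψ (layerCharClassS S (hMof K' hK hab.toIsGalois hu) (hMofS K' hK hab.toIsGalois hu)
            (ψof K' hK hab.toIsGalois hu) χK) =
          IdeleCohomology.classInvAll L.1 K' (IdeleCohomology.baseCup (E := K') x₀
            (groupCohomology.δ (Bockstein.intModShortComplex_shortExact (K' ≃ₐ[L.1] K') m) 1 2 rfl
              ((H1IsoOfIsTrivial (Rep.trivial ℤ (K' ≃ₐ[L.1] K') (ZMod m))).inv χK))))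
    (χ : groupCohomology (Rep.trivial ℤ ((layerSubgroupS S L : Subgroup (GaloisGroupUnramifiedOutside K (↑S : Set
        (HeightOneSpectrum (𝓞 K))))) ⧸ (DiscreteRep.traceOpenNormalSubgroup (layerSubgroupS S L : Subgroup
        (GaloisGroupUnramifiedOutside K (↑S : Set (HeightOneSpectrum (𝓞 K))))) (layerSubgroupS S E) : Subgroup
        (layerSubgroupS S L : Subgroup (GaloisGroupUnramifiedOutside K (↑S : Set (HeightOneSpectrum (𝓞 K)))))))
        (ZMod m)) 1) :
    haveI : NeZero m := ⟨hm.ne'⟩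
    Ψ (inflTriv (DiscreteRep.traceOpenNormalSubgroup (layerSubgroupS S L : Subgroup (GaloisGroupUnramifiedOutside K
        (↑S : Set (HeightOneSpectrum (𝓞 K))))) (layerSubgroupS S E) : Subgroup (layerSubgroupS S L : Subgroup
        (GaloisGroupUnramifiedOutside K (↑S : Set (HeightOneSpectrum (𝓞 K)))))) (LayerColimit.coe_isOpen _)
          ((RepExt.extTrivialAddEquivGroupCohomology (Rep.trivial ℤ ((layerSubgroupS S L : Subgroup
              (GaloisGroupUnramifiedOutside K (↑S : Set (HeightOneSpectrum (𝓞 K))))) ⧸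
              (DiscreteRep.traceOpenNormalSubgroup (layerSubgroupS S L : Subgroup (GaloisGroupUnramifiedOutside K
              (↑S : Set (HeightOneSpectrum (𝓞 K))))) (layerSubgroupS S E) : Subgroup (layerSubgroupS S L : Subgroup
              (GaloisGroupUnramifiedOutside K (↑S : Set (HeightOneSpectrum (𝓞 K))))))) (ZMod m)) 1).symm χ)) =
      inv (LayerColimit.inflG (DiscreteRep.traceOpenNormalSubgroup (layerSubgroupS S L : Subgroup
          (GaloisGroupUnramifiedOutside K (↑S : Set (HeightOneSpectrum (𝓞 K))))) (layerSubgroupS S E)) ((resD ℤ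
          (layerSubgroupS S L : Subgroup (GaloisGroupUnramifiedOutside K (↑S : Set (HeightOneSpectrum (𝓞 K)))))).obj
          (classBarSD K S)) 2
        (groupCohomology.map (MonoidHom.id _) (LayerColimit.homToLayer (DiscreteRep.traceOpenNormalSubgroup
            (layerSubgroupS S L : Subgroup (GaloisGroupUnramifiedOutside K (↑S : Set (HeightOneSpectrum (𝓞 K)))))
            (layerSubgroupS S E) : Subgroup (layerSubgroupS S L : Subgroup (GaloisGroupUnramifiedOutside K (↑S : Set
            (HeightOneSpectrum (𝓞 K)))))) ((resD ℤ (layerSubgroupS S L : Subgroup (GaloisGroupUnramifiedOutside K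
            (↑S : Set (HeightOneSpectrum (𝓞 K)))))).obj (classBarSD K S)) φ) 2
          (groupCohomology.δ (Bockstein.intModShortComplex_shortExact ((layerSubgroupS S L : Subgroup
              (GaloisGroupUnramifiedOutside K (↑S : Set (HeightOneSpectrum (𝓞 K))))) ⧸
              (DiscreteRep.traceOpenNormalSubgroup (layerSubgroupS S L : Subgroup (GaloisGroupUnramifiedOutside K
              (↑S : Set (HeightOneSpectrum (𝓞 K))))) (layerSubgroupS S E) : Subgroup (layerSubgroupS S L : Subgroup
              (GaloisGroupUnramifiedOutside K (↑S : Set (HeightOneSpectrum (𝓞 K))))))) m) 1 2 rfl χ))) := by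
  haveI : NeZero m := ⟨hm.ne'⟩
  haveI := L.numberField
  letI := GalLayer.algebraOfLE h
  haveI := GalLayer.isScalarTower_of_le h
  haveI := E.finiteDimensional
  haveI : FiniteDimensional L.1 E.1 := Module.Finite.of_restrictScalars_finite K L.1 E.1
  haveI := E.numberField
  haveI := E.isGalois
  haveI : IsGalois L.1 E.1 := IsGalois.tower_top_of_isGalois K L.1 E.1
  -- factor the character `χ ∘ g_S` of `Gal(E/L)` through an abelian `K' ⊆ L̄` embedded in `E`, unramified outside `S`
  -- (`Exists.elim`, not `obtain`: casing the existential against this goal is prohibitively slow)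
  have hex := exists_isAbelianGalois_unramified_character_factor (S := (↑S : Set (HeightOneSpectrum (𝓞 K))))
    (L := L) (E := E) hE (galCharacterS S h hE χ)
  refine hex.elim fun K' h₁ => h₁.elim fun hK h₂ => h₂.elim fun hab h₃ => h₃.elim fun ψ h₄ => h₄.elim fun χK h₅ => ?_
  have hu' := h₅.1
  have hfac := h₅.2
  clear h₁ h₂ h₃ h₄ h₅ hex
  haveI := hK
  have hu : ∀ w : HeightOneSpectrum (𝓞 L.1), w ∉ T → Algebra.IsUnramifiedIn (𝓞 K') w.asIdeal :=
    haveI : NumberField K' := NumberField.of_module_finite L.1 K'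
    forall_isUnramifiedIn_of_forall_under S T hT K' hu'
  -- the class of `χ` is the class of `(K', χ_{K'})` through `ψ`, and also through the chosen embedding `ψof K'`
  have h1 := inflTriv_eq_layerCharClassS S h hE ψ χK χ hfac
  have h2 : layerCharClassS S h hE ψ χK =
      layerCharClassS S (hMof K' hK hab.toIsGalois hu) (hMofS K' hK hab.toIsGalois hu)
          (ψof K' hK hab.toIsGalois hu) χK :=
    layerCharClassS_eq_of_forall_absRestrictNormalHom S h (hMof K' hK hab.toIsGalois hu) hE
        (hMofS K' hK hab.toIsGalois hu)
      K' K' ψ (ψof K' hK hab.toIsGalois hu) χK χK fun _ => rfl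
  rw [h1, h2, hΨ K' hK hab hu χK]
  exact classInvAll_baseCup_eq_layerValue_of_factor_S S h hL hE hSE hm inv hinv φ x₀ hx₀ χ K' hK hab ψ χK hfac

/-- **The vector `[c] ∈ C̄_S^{V̄_L}` of an idèle class `c ∈ C_L` as a morphism `φ : ℤ ⟶ Res_{V̄_L} C̄_S`** (`φ(1) = [c]`;
door-c4 `homTrivEquiv`, bsd-line-x1-p1-w3 `ofLayerS_mem_invariants_layerSubgroupS`).
[cite: Harari2020, §17.1 Theorem 17.2][cite: MilneADT2006, I §4] -/
theorem exists_hom_apply_one_eq_ofLayerS (hL : ramificationSubgroup K (↑S : Set (HeightOneSpectrum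
    (𝓞 K))) ≤ galFixing K L.1) (c : layerClass K L) :
    ∃ φ : triv (k := ℤ) (Γ := (layerSubgroupS S L : Subgroup (GaloisGroupUnramifiedOutside K (↑S : Set
        (HeightOneSpectrum (𝓞 K)))))) ℤ ⟶ ((resD ℤ (layerSubgroupS S L : Subgroup (GaloisGroupUnramifiedOutside K
        (↑S : Set (HeightOneSpectrum (𝓞 K)))))).obj (classBarSD K S)), ofLayerS S hL c = φ.hom.hom (1 : ℤ) := by
  have hcinv : ofLayerS S hL c ∈ (((resD ℤ (layerSubgroupS S L : Subgroup (GaloisGroupUnramifiedOutside K (↑S : Set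
      (HeightOneSpectrum (𝓞 K)))))).obj
      (classBarSD K S))).obj.ρ.invariants := ofLayerS_mem_invariants_layerSubgroupS S hL _
  have h1 := homTrivEquiv_apply_coe _ ℤ ((homTrivEquiv ((resD ℤ (layerSubgroupS S L : Subgroup
      (GaloisGroupUnramifiedOutside K (↑S : Set (HeightOneSpectrum (𝓞 K)))))).obj (classBarSD K S)) ℤ).symm
      (LinearMap.toSpanSingleton ℤ _ ⟨_, hcinv⟩)) 1
  rw [AddEquiv.apply_symm_apply, LinearMap.toSpanSingleton_apply_one] at h1
  exact ⟨_, h1⟩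

set_option synthInstance.maxHeartbeats 100000 in
set_option maxHeartbeats 800000 in
-- the arithmetic over the base `L = ↥L.1` and instance synthesis over `K' ⊆ L̄` (template §42)
/-- **The idèle of the functional.**  For every additive `Ψ : Ext¹_{C_{V̄_L}}(ℤ, ℤ/m) → ℚ/ℤ` and every choice of layers
`Mof K' ⊇ L` inside `K_S` with embeddings `ψof K' : K' → Mof K'` (for the finite Galois `K' ⊆ L̄` unramified outside the
places `T` above `S`), there is ONE idèle `x₀` of `L` with `Ψ(layerCharClassS (Mof K') (ψof K') χ_{K'}) =
inv_{K'/L}(ι[x₀] ∪ β_m[χ_{K'}])` for all finite ABELIAN such `K'` and all `χ_{K'}`: the family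
`Φ_{K'} χ_{K'} := −m·Ψ(layerCharClassS)` is additive (`layerCharClassS_add`) and compatible under THE restrictions
`Γ_L → Gal(K'/L)` (`layerCharClassS_eq_of_forall_absRestrictNormalHom`), so global class field theory with restricted
ramification over the base `L` (`exists_idele_forall_unramified_layer_pairing_eq`: reciprocity, the existence theorem,
`ψ(U_L^T) ⊆` inertia) applies. [cite: MilneADT2006, I Theorem 1.8 (b), §4][cite: Harari2020, Prop. 15.42 (a), §17.1 Theorem 17.2]
[cite: CasselsFrohlichANT1967, Ch. VII §11.3, §5.1 Main Theorem (D)] -/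
theorem exists_idele_forall_apply_layerCharClassS_eq {m : ℕ} (hm : 0 < m)
    (Ψ : Abelian.Ext (triv (k := ℤ) (Γ := (layerSubgroupS S L : Subgroup (GaloisGroupUnramifiedOutside K (↑S : Set
        (HeightOneSpectrum (𝓞 K)))))) ℤ) (triv (k := ℤ) (Γ := (layerSubgroupS S L : Subgroup
        (GaloisGroupUnramifiedOutside K (↑S : Set (HeightOneSpectrum (𝓞 K)))))) (ZMod m)) 1 →+ AddCircle (1 : ℚ))
    (T : haveI := L.numberField; Finset (HeightOneSpectrum (𝓞 L.1)))
    (Mof : haveI := L.numberField;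
      ∀ (K' : IntermediateField L.1 (AlgebraicClosure L.1)), FiniteDimensional L.1 K' → IsGalois L.1 K' →
        (∀ w : HeightOneSpectrum (𝓞 L.1), w ∉ T → Algebra.IsUnramifiedIn (𝓞 K') w.asIdeal) → GalLayer K)
    (hMof : haveI := L.numberField; ∀ K' hK hG hu, L ≤ Mof K' hK hG hu)
    (hMofS : haveI := L.numberField; ∀ K' hK hG hu, ramificationSubgroup K (↑S : Set (HeightOneSpectrum
        (𝓞 K))) ≤ galFixing K (Mof K' hK hG hu).1)
    (ψof : haveI := L.numberField;
      ∀ K' hK hG hu, letI := GalLayer.algebraOfLE (hMof K' hK hG hu); K' →ₐ[L.1] (Mof K' hK hG hu).1) :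
    haveI := L.numberField; haveI : NeZero m := ⟨hm.ne'⟩
    ∃ x₀ : ideleGroup L.1,
      ∀ (K' : IntermediateField L.1 (AlgebraicClosure L.1)) (hK : FiniteDimensional L.1 K')
          (hab : IsAbelianGalois L.1 K')
        (hu : ∀ w : HeightOneSpectrum (𝓞 L.1), w ∉ T → Algebra.IsUnramifiedIn (𝓞 K') w.asIdeal)
        (χK : Additive (K' ≃ₐ[L.1] K') →+ ZMod m),
        haveI : NumberField K' := NumberField.of_module_finite L.1 K'
        Ψ (layerCharClassS S (hMof K' hK hab.toIsGalois hu) (hMofS K' hK hab.toIsGalois hu)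
            (ψof K' hK hab.toIsGalois hu) χK) =
          IdeleCohomology.classInvAll L.1 K' (IdeleCohomology.baseCup (E := K') x₀
            (groupCohomology.δ (Bockstein.intModShortComplex_shortExact (K' ≃ₐ[L.1] K') m) 1 2 rfl
              ((H1IsoOfIsTrivial (Rep.trivial ℤ (K' ≃ₐ[L.1] K') (ZMod m))).inv χK))) := by
  haveI : NeZero m := ⟨hm.ne'⟩
  haveI := L.numberField
  -- (1) the functional `Φ_{K'}` on the characters of the finite Galois `K' ⊆ L̄`: `Φ_{K'} χ / m = -Ψ(layerCharClassS)`
  have htors : ∀ (K' : IntermediateField L.1 (AlgebraicClosure L.1)) (hK : FiniteDimensional L.1 K')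
      (hG : IsGalois L.1 K') (hu : ∀ w : HeightOneSpectrum (𝓞 L.1), w ∉ T → Algebra.IsUnramifiedIn (𝓞 K') w.asIdeal)
      (χK : Additive (K' ≃ₐ[L.1] K') →+ ZMod m),
      m • -Ψ (layerCharClassS S (hMof K' hK hG hu) (hMofS K' hK hG hu) (ψof K' hK hG hu) χK) = 0 :=
    fun K' hK hG hu χK => by
      rw [smul_neg, nsmul_apply_layerCharClassS_eq_zero, neg_zero]
  have key : ∀ (K' : IntermediateField L.1 (AlgebraicClosure L.1)) (χK : Additive (K' ≃ₐ[L.1] K') →+ ZMod m),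
      ∃ a : ZMod m, ∀ (hK : FiniteDimensional L.1 K') (hG : IsGalois L.1 K')
        (hu : ∀ w : HeightOneSpectrum (𝓞 L.1), w ∉ T → Algebra.IsUnramifiedIn (𝓞 K') w.asIdeal),
        zmodToQmodZ m a = -Ψ (layerCharClassS S (hMof K' hK hG hu) (hMofS K' hK hG hu) (ψof K' hK hG hu) χK) :=
    fun K' χK => by
      by_cases hK : FiniteDimensional L.1 K'
      · by_cases hG : IsGalois L.1 K'
        · by_cases hu : ∀ w : HeightOneSpectrum (𝓞 L.1), w ∉ T → Algebra.IsUnramifiedIn (𝓞 K') w.asIdeal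
          · exact ⟨(exists_zmodToQmodZ_eq_of_nsmul_eq_zero m (htors K' hK hG hu χK)).choose, fun _ _ _ =>
              (exists_zmodToQmodZ_eq_of_nsmul_eq_zero m (htors K' hK hG hu χK)).choose_spec⟩
          · exact ⟨0, fun _ _ hu' => (hu hu').elim⟩
        · exact ⟨0, fun _ hG' _ => (hG hG').elim⟩
      · exact ⟨0, fun hK' _ _ => (hK hK').elim⟩
  choose Φ hΦ using key
  -- (2) `Φ` is additive and compatible on the finite ABELIAN `K' ⊆ L̄` unramified outside `T`
  have hadd : ∀ (K' : IntermediateField L.1 (AlgebraicClosure L.1)) [FiniteDimensional L.1 K']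
      [IsAbelianGalois L.1 K'],
      (∀ w : HeightOneSpectrum (𝓞 L.1), w ∉ T → Algebra.IsUnramifiedIn (𝓞 K') w.asIdeal) →
      ∀ (χ χ' : Additive (K' ≃ₐ[L.1] K') →+ ZMod m), Φ K' (χ + χ') = Φ K' χ + Φ K' χ' := by
    intro K' hK hab hu χ χ'
    apply zmodToQmodZ_injective m
    rw [map_add, hΦ K' _ hK hab.toIsGalois hu, hΦ K' _ hK hab.toIsGalois hu, hΦ K' _ hK hab.toIsGalois hu,
      layerCharClassS_add]
    exact (congrArg Neg.neg (map_add Ψ _ _)).trans (neg_add _ _)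
  have hcompat : ∀ (K' K'' : IntermediateField L.1 (AlgebraicClosure L.1)) [FiniteDimensional L.1 K']
      [IsAbelianGalois L.1 K'] [FiniteDimensional L.1 K''] [IsAbelianGalois L.1 K''],
      (∀ w : HeightOneSpectrum (𝓞 L.1), w ∉ T → Algebra.IsUnramifiedIn (𝓞 K') w.asIdeal) →
      (∀ w : HeightOneSpectrum (𝓞 L.1), w ∉ T → Algebra.IsUnramifiedIn (𝓞 K'') w.asIdeal) →
      ∀ (χ : Additive (K' ≃ₐ[L.1] K') →+ ZMod m) (χ' : Additive (K'' ≃ₐ[L.1] K'') →+ ZMod m),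
      (∀ γ : absoluteGaloisGroup L.1,
        χ (Additive.ofMul (absRestrictNormalHom K' γ)) = χ' (Additive.ofMul (absRestrictNormalHom K'' γ))) →
      Φ K' χ = Φ K'' χ' := by
    intro K' K'' hK hab hK' hab' hu hu' χ χ' hγ
    apply zmodToQmodZ_injective m
    rw [hΦ K' χ hK hab.toIsGalois hu, hΦ K'' χ' hK' hab'.toIsGalois hu']
    exact congrArg (fun y => -Ψ y)
      (layerCharClassS_eq_of_forall_absRestrictNormalHom S (hMof K' hK hab.toIsGalois hu)
        (hMof K'' hK' hab'.toIsGalois hu') (hMofS K' hK hab.toIsGalois hu) (hMofS K'' hK' hab'.toIsGalois hu') K' K''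
        (ψof K' hK hab.toIsGalois hu) (ψof K'' hK' hab'.toIsGalois hu') χ χ' hγ)
  -- (3) the idèle (global class field theory with restricted ramification over the base `L`)
  refine (exists_idele_forall_unramified_layer_pairing_eq (K := L.1) hm T Φ hadd hcompat).imp fun x₀ hx₀ => ?_
  intro K' hK hab hu χK
  exact neg_injective ((hΦ K' χK hK hab.toIsGalois hu).symm.trans (hx₀ K' hK hab hu χK))

set_option synthInstance.maxHeartbeats 100000 in
set_option maxHeartbeats 800000 in
-- the big unfolded layer terms (template §42)
/-- **Milne's (b) for `(↥V̄_L, Res C̄_S)`, surjectivity side.**  Let `inv` satisfy `hinv` at every layer `E ⊇ L` inside `K_S`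
(e.g. `inv = invAt (classBarSD K S) inv_S V̄_L`, bsd-line-x1-p1-w5's `invAt_classBarSD_inflG`).  For every additive
`Ψ : Ext¹_{C_{V̄_L}}(ℤ, ℤ/m) → ℚ/ℤ` there is a morphism `φ : ℤ ⟶ Res_{V̄_L} C̄_S` (an invariant vector `[x₀] ∈ C̄_S^{V̄_L} = im C_L`)
with `Ψ (inflTriv (E⁻¹ χ)) = inv (Inf (H²(id, φ_V) (β_m χ)))` for every layer `E ⊇ L` inside `K_S` and every
`χ ∈ H¹(↥V̄_L ⧸ (V̄_E ∩ V̄_L), ℤ/m)` — the hypothesis `Hsurj` of door-c4 g16's `adjointSurjective_triv_zmod_of_cofinal` on the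
S-trace layers (every finite Galois `K'/L` unramified outside `T` embeds into a layer of `K_S`,
`GalLayer.exists_ge_insideKS_nonempty_algHom`; the idèle from `exists_idele_forall_apply_layerCharClassS_eq`; the layer
identity from `apply_inflTriv_eq_layerValue_S`). [cite: MilneADT2006, I Theorem 1.8 (b), §4]
[cite: Harari2020, Prop. 15.42 (a), §17.1 Theorem 17.2][cite: CasselsFrohlichANT1967, Ch. VII §11.3, §5.1 Main Theorem
    (D)] -/
theorem exists_hom_forall_layer_value_eq_S
    (hL : ramificationSubgroup K (↑S : Set (HeightOneSpectrum (𝓞 K))) ≤ galFixing K L.1) {m : ℕ} (hm : 0 < m)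
        (inv : Abelian.Ext (triv (k := ℤ) (Γ := (layerSubgroupS S L : Subgroup (GaloisGroupUnramifiedOutside K
        (↑S : Set (HeightOneSpectrum (𝓞 K)))))) ℤ) ((resD ℤ (layerSubgroupS S L : Subgroup
        (GaloisGroupUnramifiedOutside K (↑S : Set (HeightOneSpectrum (𝓞 K)))))).obj (classBarSD K S)) 2 →+ AddCircle
        (1 : ℚ))
    (hinv : ∀ (E : GalLayer K) (hE : ramificationSubgroup K (↑S : Set (HeightOneSpectrum (𝓞 K))) ≤ galFixing K E.1)
      (hSE : ∀ v : HeightOneSpectrum (𝓞 K), v ∉ S → (haveI := E.numberField; Algebra.IsUnramifiedIn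
          (𝓞 E.1) v.asIdeal))
      (h : L ≤ E) (x : groupCohomology (relLayerRepS S (layerSubgroupS S L : Subgroup (GaloisGroupUnramifiedOutside K
          (↑S : Set (HeightOneSpectrum (𝓞 K))))) E) 2),
      inv (LayerColimit.inflG (DiscreteRep.traceOpenNormalSubgroup (layerSubgroupS S L : Subgroup
          (GaloisGroupUnramifiedOutside K (↑S : Set (HeightOneSpectrum (𝓞 K))))) (layerSubgroupS S E)) ((resD ℤ
          (layerSubgroupS S L : Subgroup (GaloisGroupUnramifiedOutside K (↑S : Set (HeightOneSpectrum (𝓞 K)))))).obj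
          (classBarSD K S)) 2 x) =
        (haveI := E.numberField; haveI := E.isGalois; haveI := finite_gal K E;
          (IdeleCohomology.isClassModule_classModUnitsCocycle S hSE).invSub (subgroupImageS S hE
              (layerSubgroupS S L : Subgroup (GaloisGroupUnramifiedOutside K (↑S : Set (HeightOneSpectrum (𝓞 K))))))
            ((relLayerSCohomologyIso S hE (layerSubgroupS_anti S h) 2).hom x)))
    (Ψ : Abelian.Ext (triv (k := ℤ) (Γ := (layerSubgroupS S L : Subgroup (GaloisGroupUnramifiedOutside K (↑S : Set
        (HeightOneSpectrum (𝓞 K)))))) ℤ) (triv (k := ℤ) (Γ := (layerSubgroupS S L : Subgroup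
        (GaloisGroupUnramifiedOutside K (↑S : Set (HeightOneSpectrum (𝓞 K)))))) (ZMod m)) 1 →+ AddCircle (1 : ℚ)) :
    ∃ φ : triv (k := ℤ) (Γ := (layerSubgroupS S L : Subgroup (GaloisGroupUnramifiedOutside K (↑S : Set
        (HeightOneSpectrum (𝓞 K)))))) ℤ ⟶ ((resD ℤ (layerSubgroupS S L : Subgroup (GaloisGroupUnramifiedOutside K
        (↑S : Set (HeightOneSpectrum (𝓞 K)))))).obj (classBarSD K S)),
      ∀ (E : GalLayer K) (_ : ramificationSubgroup K (↑S : Set (HeightOneSpectrum (𝓞 K))) ≤ galFixing K E.1)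
          (_ : L ≤ E) (χ : groupCohomology (Rep.trivial ℤ ((layerSubgroupS S L : Subgroup
          (GaloisGroupUnramifiedOutside K (↑S : Set (HeightOneSpectrum (𝓞 K))))) ⧸
          (DiscreteRep.traceOpenNormalSubgroup (layerSubgroupS S L : Subgroup (GaloisGroupUnramifiedOutside K
          (↑S : Set (HeightOneSpectrum (𝓞 K))))) (layerSubgroupS S E) : Subgroup (layerSubgroupS S L : Subgroup
          (GaloisGroupUnramifiedOutside K (↑S : Set (HeightOneSpectrum (𝓞 K))))))) (ZMod m)) 1),
        haveI : NeZero m := ⟨hm.ne'⟩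
        Ψ (inflTriv (DiscreteRep.traceOpenNormalSubgroup (layerSubgroupS S L : Subgroup
            (GaloisGroupUnramifiedOutside K (↑S : Set (HeightOneSpectrum (𝓞 K))))) (layerSubgroupS S E) : Subgroup
            (layerSubgroupS S L : Subgroup (GaloisGroupUnramifiedOutside K (↑S : Set (HeightOneSpectrum (𝓞 K))))))
            (LayerColimit.coe_isOpen _)
          ((RepExt.extTrivialAddEquivGroupCohomology (Rep.trivial ℤ ((layerSubgroupS S L : Subgroup
              (GaloisGroupUnramifiedOutside K (↑S : Set (HeightOneSpectrum (𝓞 K))))) ⧸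
              (DiscreteRep.traceOpenNormalSubgroup (layerSubgroupS S L : Subgroup (GaloisGroupUnramifiedOutside K
              (↑S : Set (HeightOneSpectrum (𝓞 K))))) (layerSubgroupS S E) : Subgroup (layerSubgroupS S L : Subgroup
              (GaloisGroupUnramifiedOutside K (↑S : Set (HeightOneSpectrum (𝓞 K))))))) (ZMod m)) 1).symm χ)) =
          inv (LayerColimit.inflG (DiscreteRep.traceOpenNormalSubgroup (layerSubgroupS S L : Subgroup
              (GaloisGroupUnramifiedOutside K (↑S : Set (HeightOneSpectrum (𝓞 K))))) (layerSubgroupS S E)) ((resD ℤ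
              (layerSubgroupS S L : Subgroup (GaloisGroupUnramifiedOutside K (↑S : Set (HeightOneSpectrum
              (𝓞 K)))))).obj (classBarSD K S)) 2
        (groupCohomology.map (MonoidHom.id _) (LayerColimit.homToLayer (DiscreteRep.traceOpenNormalSubgroup
            (layerSubgroupS S L : Subgroup (GaloisGroupUnramifiedOutside K (↑S : Set (HeightOneSpectrum (𝓞 K)))))
            (layerSubgroupS S E) : Subgroup (layerSubgroupS S L : Subgroup (GaloisGroupUnramifiedOutside K (↑S : Set
            (HeightOneSpectrum (𝓞 K)))))) ((resD ℤ (layerSubgroupS S L : Subgroup (GaloisGroupUnramifiedOutside K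
            (↑S : Set (HeightOneSpectrum (𝓞 K)))))).obj (classBarSD K S)) φ) 2
          (groupCohomology.δ (Bockstein.intModShortComplex_shortExact ((layerSubgroupS S L : Subgroup
              (GaloisGroupUnramifiedOutside K (↑S : Set (HeightOneSpectrum (𝓞 K))))) ⧸
              (DiscreteRep.traceOpenNormalSubgroup (layerSubgroupS S L : Subgroup (GaloisGroupUnramifiedOutside K
              (↑S : Set (HeightOneSpectrum (𝓞 K))))) (layerSubgroupS S E) : Subgroup (layerSubgroupS S L : Subgroup
              (GaloisGroupUnramifiedOutside K (↑S : Set (HeightOneSpectrum (𝓞 K))))))) m) 1 2 rfl χ))) := by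
  haveI : NeZero m := ⟨hm.ne'⟩
  haveI := L.numberField
  -- the places `T` of `L` above `S`
  obtain ⟨T, hT⟩ := exists_finset_forall_mem_iff_under_mem (K := K) L.1 S
  -- (1) a layer `Mof K' ⊇ L` INSIDE `K_S` and an `L`-embedding `ψof K' : K' → Mof K'` for every finite Galois `K' ⊆ L̄`
  -- unramified outside `T` (`GalLayer.exists_ge_insideKS_nonempty_algHom`)
  have hex : ∀ (K' : IntermediateField L.1 (AlgebraicClosure L.1)), FiniteDimensional L.1 K' → IsGalois L.1 K' →
      (∀ w : HeightOneSpectrum (𝓞 L.1), w ∉ T → Algebra.IsUnramifiedIn (𝓞 K') w.asIdeal) →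
      ∃ (M : GalLayer K) (h : L ≤ M), ramificationSubgroup K (↑S : Set (HeightOneSpectrum
          (𝓞 K))) ≤ galFixing K M.1 ∧ Nonempty (letI := GalLayer.algebraOfLE h; K' →ₐ[L.1] M.1) :=
    fun K' hK hG hunr => by
      haveI := hK
      haveI := hG
      haveI : NumberField K' := NumberField.of_module_finite L.1 K'
      exact GalLayer.exists_ge_insideKS_nonempty_algHom (S := (↑S : Set (HeightOneSpectrum (𝓞 K)))) L hL K'
        fun v hv => isUnramifiedIn_of_forall_not_mem_above S hL T hT K' hunr fun hv' => hv (Finset.mem_coe.2 hv')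
  choose Mof hMof hMofS hψ using hex
  -- (2) the idèle `x₀` of the functional and (3) the invariant vector `φ` of its class `[x₀] ∈ C̄_S^{V̄_L}`
  refine (exists_idele_forall_apply_layerCharClassS_eq S hm Ψ T Mof hMof hMofS fun K' hK hG hu =>
    (hψ K' hK hG hu).some).elim fun x₀ hx₀ => ?_
  refine (exists_hom_apply_one_eq_ofLayerS S hL (Additive.ofMul (x₀ : IdeleClassGroup L.1))).elim fun φ hφ => ?_
  refine ⟨φ, fun E hE h χ => ?_⟩
  -- the layer `E ⊆ K_S` is unramified outside `S`
  have hSE : ∀ v : HeightOneSpectrum (𝓞 K), v ∉ S → (haveI := E.numberField; Algebra.IsUnramifiedIn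
      (𝓞 E.1) v.asIdeal) :=
    fun v hv => GalLayer.isUnramifiedIn_of_insideKS (S := (↑S : Set (HeightOneSpectrum (𝓞 K)))) E hE
      fun hv' => hv (Finset.mem_coe.1 hv')
  -- (4) the layer identity
  exact apply_inflTriv_eq_layerValue_S S h hL hE hSE hm inv (hinv E hE hSE h) Ψ φ x₀ hφ T hT Mof hMof hMofS
    (fun K' hK hG hu => (hψ K' hK hG hu).some) hx₀ χ

end IdeleClassBar

end Literature.NumberTheory.GaloisRepresentations

end
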